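import Summits.QuantumFields.QCD.Theses.AnomalyRigidity

/-!
# `UniformGapTreeDecay` (stmt-QuantumFields-16260, route AnomalyRigidity) — negative lemma modulo a
# gapped regularisation with non-degenerate partition function

`UniformGapTreeDecay` quantifies over ALL `N_f`, ALL regularisations and ALL observables `V_μ, P`
with weights, and concludes exponential TREE DECAY of the UNTRUNCATED three-point function
`u³⟨V_μ(x) V_ν(y) P(0)⟩` from a uniform lattice gap.  For the unit observable `V_μ = P = 1`
(`QCDLatticeObservable.one`, weights `1`) the truncated reflected pair hypothesis is `⟨1⟩ - ⟨1⟩⟨1⟩ = 0`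
and the three-point function is `⟨1·1·1⟩ = 1`, which does not decay.  Hence ANY regularisation with a
uniform lattice gap on the mass window, bare masses on the physical branch and `⟨1⟩ = 1` (signed
partition function non-zero) refutes the crux.  Such regularisations exist classically — `N_f = 0`,
`β_k ≡ 0` (product Haar measure: connected correlations of cylinder observables vanish identically
beyond their diameter, `⟨1⟩ = 1`), or `N_f = 2`, `β_k ≡ 0`, `m_crit ≡ M ≫ 1` (hopping/cluster
expansion, Osterwalder–Seiler 1978; cf. `Literature.Barriers.QuantumFields.HoppingExpansionUniformGap`)
— but are not yet constructed over the tree's `qcdTorusExpect`, so the result is filed as a negative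
lemma MODULO `GappedUnitRegularisation N_f`.  Repair for the planner: add the vanishing of the
one-point functions `⟨V_μ(x)⟩ = ⟨P(0)⟩ = 0` (true for honest currents by lattice symmetries) or state
the decay for the fully truncated three-point function, and restrict `N_f ∈ {2, 3}`.
Refuter seat refuter-rreview-0816T18-0-0 (route review), 2026-08-16.
-/

noncomputable section

namespace Summit.QuantumFields.QCD.Theorems.UniformGapTreeDecay.Negative

open Filter Topology
open Literature.MathematicalPhysics.QuantumFieldTheory Literature.Probability.LatticeModels
open Summit.QuantumFields.QCD.Theses.AnomalyRigidity

/-- **H — a gapped regularisation with non-degenerate partition function** (the object the negative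
lemma is taken modulo): a mass-independent regularisation `reg` of `N_f`-flavour lattice QCD and a
rate `ε > 0` such that on the mass window `m ∈ (0, 1]` (degenerate tuples `m·1`, `z = shift = 0`)
the scheme has the uniform lattice mass gap `ε` (`QCDScheme.HasLatticeMassGap`), its bare masses are
eventually on the physical branch `> -1`, and the torus functional is normalised, `⟨1⟩_{k,S} = 1`
(signed partition function `≠ 0`) at every step and volume.  Inhabited classically at `N_f = 0`,
`β ≡ 0` (ultralocal product Haar measure) and at `N_f = 2` in the strong-coupling / heavy-quark
corner (Osterwalder–Seiler cluster expansion); not yet constructed in the tree.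
[cite: OsterwalderSeiler1978, §§2–4] [topic: MathematicalPhysics/QuantumFieldTheory] -/
def GappedUnitRegularisation (Nf : ℕ) : Prop :=
  ∃ reg : QCDRegularisation Nf, ∃ ε : ℝ, 0 < ε ∧
    (∀ m : ℝ, 0 < m → m ≤ 1 → (reg.scheme (fun _ : Fin Nf => m) 0 0).HasLatticeMassGap ε) ∧
    (∀ m : ℝ, 0 < m → m ≤ 1 → ∀ fl : Fin Nf, ∀ᶠ k in atTop,
      (-1 : ℝ) < (reg.scheme (fun _ : Fin Nf => m) 0 0).mq fl k) ∧
    (∀ (m : ℝ) (k S : ℕ), qcdTorusExpect (reg.β k) (2 * S + 1)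
      (fun fl => (reg.scheme (fun _ : Fin Nf => m) 0 0).mq fl k)
      (fun _ => (1 : FermiAlg Nf (2 * S + 1))) = 1)

/-- The unit observable placed anywhere on any torus is the unit of the torus Grassmann algebra. [folklore] -/
theorem one_onTorus (Nf R S : ℕ) [NeZero S] (v : Site 4)
    (U : GaugeConfig 4 S (Matrix.specialUnitaryGroup (Fin 3) ℂ)) :
    (QCDLatticeObservable.one Nf R).onTorus S v U = 1 := by
  simp [QCDLatticeObservable.onTorus, QCDLatticeObservable.one]

/-- **`UniformGapTreeDecay` is false modulo `GappedUnitRegularisation N_f`** (any `N_f`): feed the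
crux the gapped regularisation, the unit observables `V_μ = P = 1` with weights `1`, `m₁ = 1`; the
pair hypothesis holds with `σ = 0`, `C = 0` (`⟨Θ1Θ1·1·1⟩ - ⟨Θ1Θ1⟩⟨1·1⟩ = 0` because `⟨1⟩ = 1`), and the
concluded bound `1 = ‖⟨1·1·1⟩‖ ≤ C e^{-ε' a_k N} (1 + a_k^{-σ})` at `x = N e₀`, `y = 0` on the torus of
half-side `max(L_k, N)` fails for `N` large. [folklore] -/
theorem uniformGapTreeDecay_false_of_gapped {Nf : ℕ} (hH : GappedUnitRegularisation Nf) :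
    ¬ UniformGapTreeDecay := by
  intro h
  obtain ⟨reg, ε, hε, hgap, hbranch, hone⟩ := hH
  have key := h Nf reg (fun _ => QCDLatticeObservable.one Nf 1) (QCDLatticeObservable.one Nf 1)
    (fun _ => 1) (fun _ => 1) ε 1 ?pair hε one_pos le_rfl hgap hbranch
  case pair =>
    refine ⟨0, by norm_num, fun τ _ => ⟨0, fun m _ _ ι₁ ι₂ => Eventually.of_forall ?_⟩⟩
    intro k S _ x _ y _ _ _ _ _
    have h1 := hone m k S
    simp only [QCDRegularisation.scheme_mq] at h1
    rcases ι₁ with _ | _ | _ <;> rcases ι₂ with _ | _ | _ <;>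
      simp [one_onTorus, h1]
  obtain ⟨C, ε', σ, R₀, hε', -, hmain⟩ := key
  obtain ⟨k, hk⟩ := (hmain 1 one_pos le_rfl 0 0).exists
  have ha : 0 < reg.a k := reg.a_pos k
  -- choose `N` large
  have hexp : Tendsto (fun N : ℕ => |C| * (1 + reg.a k ^ (-σ)) * Real.exp (-(ε' * (reg.a k * N))))
      atTop (𝓝 0) := by
    have h1 : Tendsto (fun N : ℕ => ε' * (reg.a k * (N : ℝ))) atTop atTop :=
      (tendsto_natCast_atTop_atTop.const_mul_atTop ha).const_mul_atTop hε'
    have h2 : Tendsto (fun N : ℕ => Real.exp (-(ε' * (reg.a k * (N : ℝ))))) atTop (𝓝 0) :=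
      Real.tendsto_exp_atBot.comp (tendsto_neg_atTop_atBot.comp h1)
    simpa using (tendsto_const_nhds (x := |C| * (1 + reg.a k ^ (-σ)))).mul h2
  have hev1 : ∀ᶠ N : ℕ in atTop,
      |C| * (1 + reg.a k ^ (-σ)) * Real.exp (-(ε' * (reg.a k * N))) < 1 :=
    hexp.eventually (gt_mem_nhds one_pos)
  have hev2 : ∀ᶠ N : ℕ in atTop, R₀ ≤ reg.a k * N :=
    (tendsto_natCast_atTop_atTop.const_mul_atTop ha).eventually_ge_atTop R₀
  obtain ⟨N, hN1, hN2⟩ := (hev1.and hev2).exists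
  -- the far point `x = N e₀`, the near point `y = 0`, the volume `S = max (L_k, N)`
  set x : Site 4 := fun i => if i = 0 then (N : ℤ) else 0 with hx_def
  have hx : x ∈ box 4 (max (reg.L k) N) := by
    rw [mem_box]
    intro i
    by_cases hi : i = 0
    · simp only [hx_def, hi, if_true]
      constructor
      · omega
      · exact_mod_cast le_max_right (reg.L k) N
    · simp only [hx_def, hi, if_false]
      constructor <;> omega
  have hy : (0 : Site 4) ∈ box 4 (max (reg.L k) N) := zero_mem_box 4 _
  have hk' := hk (max (reg.L k) N) (le_max_left _ _) x hx 0 hy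
  -- norms of the physical positions
  have hx0 : x 0 = N := by simp [hx_def]
  have hphx : reg.a k * N ≤ ‖fun i : Fin 4 => reg.a k * (x i : ℝ)‖ := by
    have hle : ‖reg.a k * ((x 0 : ℤ) : ℝ)‖ ≤ ‖fun i : Fin 4 => reg.a k * (x i : ℝ)‖ :=
      norm_le_pi_norm (fun i : Fin 4 => reg.a k * (x i : ℝ)) 0
    rw [hx0, Int.cast_natCast, Real.norm_eq_abs, abs_of_nonneg (by positivity)] at hle
    exact hle
  have hph0 : (fun (k : ℕ) (x : Fin 4 → ℤ) (i : Fin 4) => reg.a k * (x i : ℝ)) k 0 = 0 := by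
    funext i
    simp
  have hmax : R₀ ≤ max ‖fun i : Fin 4 => reg.a k * (x i : ℝ)‖
      ‖fun i : Fin 4 => reg.a k * ((0 : Fin 4 → ℤ) i : ℝ)‖ :=
    hN2.trans (hphx.trans (le_max_left _ _))
  have hk'' := hk' hmax
  rw [hph0] at hk''
  have h1 := hone 1 k (max (reg.L k) N)
  simp only [one_onTorus, mul_one, Complex.ofReal_one, norm_one, h1, norm_zero,
    sub_zero] at hk''
  have hn : 0 ≤ ‖fun i : Fin 4 => reg.a k * (x i : ℝ)‖ := norm_nonneg _
  rw [min_eq_left hn, min_eq_right hn, add_zero, max_eq_left hn] at hk''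
  -- `hk''` : 1 ≤ C * exp (-(ε' * ‖ξ‖)) * (1 + a_k ^ (-σ)); bound the right-hand side
  have hRHS : C * Real.exp (-(ε' * ‖fun i : Fin 4 => reg.a k * (x i : ℝ)‖)) * (1 + reg.a k ^ (-σ)) ≤
      |C| * (1 + reg.a k ^ (-σ)) * Real.exp (-(ε' * (reg.a k * N))) := by
    calc C * Real.exp (-(ε' * ‖fun i : Fin 4 => reg.a k * (x i : ℝ)‖)) * (1 + reg.a k ^ (-σ))
        ≤ |C| * Real.exp (-(ε' * ‖fun i : Fin 4 => reg.a k * (x i : ℝ)‖)) * (1 + reg.a k ^ (-σ)) := by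
          gcongr
          exact le_abs_self C
      _ ≤ |C| * Real.exp (-(ε' * (reg.a k * N))) * (1 + reg.a k ^ (-σ)) := by gcongr
      _ = |C| * (1 + reg.a k ^ (-σ)) * Real.exp (-(ε' * (reg.a k * N))) := by ring
  linarith
  
end Summit.QuantumFields.QCD.Theorems.UniformGapTreeDecay.Negative

end
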